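import Summits.AnomalousDissipation.AnomalousDissipation.Theses.SawtoothPulseCascade
import Summits.AnomalousDissipation.AnomalousDissipation.Theorems.SawtoothPulseCascadeK3LocalisedClosureDriftFreeClosure
import Summits.AnomalousDissipation.AnomalousDissipation.Theorems.SawtoothPulseCascadeK3LocalisedClosureExistence
import Summits.AnomalousDissipation.AnomalousDissipation.Theorems.SawtoothPulseCascadeConstructionRegular58

/-!
# K3loc from an approximate solution at the SINGLE glue point `(γ, ρN) = (5, 2)` (pre-certified re-glue)
(route `AnomalousDissipation/SawtoothPulseCascade`; helper for the crux ApproxSol58 = stmt-AnomalousDissipation-19688 and its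
split parent K3loc = stmt-AnomalousDissipation-19492)

The glue of the split crux `K3LocalisedClosure` (= `K1LocalisedCascade → K2LinearisedCascadeGrowth → Target`) consumes the box
`[5,8] × {2,…,7}` only through the point `(5, 2)` (`k3LocalisedClosureGlue_proof`, p457044; `DriftFreeClosure.stub_driftFreeClosure`
is pointwise via `DriftFreeClosure.planarAnomalousFamily_of`).  Two lines are now converging on `ApproxSol58` from below the full
box: the lead's `lip-agmon` (K2″ alone ⇒ the Lipschitz envelope wherever `4ρN² < γ² − 3`, in particular at `ρN = 2`; skeleton
`approxSol58_two_of : K2″ → ∀ γ ∈ [5,8], ApproximateSolution ⟨γ,¼,2,1,2⟩ (γ²−3)` modulo one stub) and the support seat's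
K2Lip-conditional closer on the whole box (`ApproxResponse.approxSol58_of_lipschitzCap`, p501235).  The planner's pre-decided
contingency for a sub-box statement is «NEW item over a sub-box ∋ (5,2) + re-glue via `planarAnomalousFamily_of` + `liftClassical`».

This file PRE-CERTIFIES that re-glue, so that any of the following closes `K3LocalisedClosure` (hence the rung `Target`, given
`K1LocalisedCascade` and `K2LinearisedCascadeGrowth`) by ONE application:

* `k3LocalisedClosure_of_approxSol_point` — from `K2″ → ApproximateSolution ⟨5,¼,2,1,2⟩ (5²−3)` (the single glue point);
* `k3LocalisedClosure_of_approxSol_two` — from `K2″ → ∀ γ ∈ [5,8], ApproximateSolution ⟨γ,¼,2,1,2⟩ (γ²−3)` (the lead's target shape);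
* `target_of_approxSol_point` — the rung `Target` from `K1LocalisedCascade`, `K2LinearisedCascadeGrowth` and the point statement.

Ingredients, all landed: `Theorems.stub_regularity` (p445324, `ConstructionRegular` on the box), `DriftFreeExistence.stub_existence`
(p452816), `DriftFreeClosure.planarAnomalousFamily_of` + `exists_norm_planarForce_le` (p444010 / p443818), and the lift
`DriftFree.liftClassical` exactly as in `k3LocalisedClosureGlue_proof`.
-/

set_option linter.dupNamespace false

noncomputable section

namespace Summit.AnomalousDissipation.AnomalousDissipation.Theorems.SawtoothPulseCascade

open Set
open Literature.Analysis Literature.Analysis.FunctionSpaces Literature.Analysis.FluidPDE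
open Literature.Analysis.FluidPDE.SawtoothCascade
open Summit.AnomalousDissipation.AnomalousDissipation.Theses.SawtoothPulseCascade

/-- **K3loc from the approximate solution at the glue point.**  If K2″ gives the Grenier approximate solution at the single
box point `(γ, ρN) = (5, 2)` (rate `5² − 3 = 22`), then `K3LocalisedClosure` holds: K1loc at `(5,2)`, the landed packaging
(`stub_regularity`, `stub_existence`) and `planarAnomalousFamily_of` give the planar anomalous family there, and its 2½-D lift is
the Target's family (verbatim the landed glue `k3LocalisedClosureGlue_proof`). -/
theorem k3LocalisedClosure_of_approxSol_point
    (hA : K2LinearisedCascadeGrowth → DriftFree.ApproximateSolution ⟨5, 1 / 4, 2, 1, 2⟩ ((5 : ℝ) ^ 2 - 3)) :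
    K3LocalisedClosure := by
  intro hK1 hK2
  have h5 : (5 : ℝ) ∈ Set.Icc (5 : ℝ) 8 := ⟨le_rfl, by norm_num⟩
  have h2' : (2 : ℕ) ∈ Finset.Icc 2 7 := by simp
  obtain ⟨hdat, hfs, hhold⟩ := Summit.AnomalousDissipation.AnomalousDissipation.Theorems.stub_regularity 5 h5 2 h2'
  have hex := DriftFreeExistence.stub_existence 5 h5 2 h2'
  obtain ⟨hfs', hloc⟩ := hK1 5 h5 2 h2'
  obtain ⟨C, hC⟩ := DriftFreeClosure.exists_norm_planarForce_le ⟨5, 1 / 4, 2, 1, 2⟩ (by norm_num) (by norm_num) le_rfl le_rfl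
  have hfam := DriftFreeClosure.planarAnomalousFamily_of hfs' hloc hex (hA hK2) hC
  obtain ⟨ν, hν, V, φ, R, hm, hAD⟩ := hfam
  refine ⟨ν, Literature.Analysis.FluidPDE.SawtoothCascade.DriftFree.liftedDatum,
    Literature.Analysis.FluidPDE.SawtoothCascade.DriftFree.liftedForce ⟨5, 1 / 4, 2, 1, 2⟩,
    fun m t => Literature.Analysis.FunctionSpaces.Torus.twoHalf (V m t) (R m t),
    fun m t => φ m t ∘ Literature.Analysis.FunctionSpaces.Torus.planarProj, hν, hdat, hhold, hfs,
    fun m => ⟨?_, ?_, (hm m).2.2.2.2⟩, hAD⟩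
  · exact Literature.Analysis.FluidPDE.SawtoothCascade.DriftFree.liftClassical _ _ _ _ _ (hm m).1 (hm m).2.2.1
  · show Literature.Analysis.FunctionSpaces.Torus.twoHalf (V m 0) (R m 0) =
        Literature.Analysis.FluidPDE.SawtoothCascade.DriftFree.liftedDatum
    rw [(hm m).2.1, (hm m).2.2.2.1]
    rfl

/-- **K3loc from the approximate solution on the line `ρN = 2`** (the output shape of the lead's line `lip-agmon`,
`approxSol58_two_of`): specialise to `γ = 5`. -/
theorem k3LocalisedClosure_of_approxSol_two
    (hA : K2LinearisedCascadeGrowth → ∀ γ ∈ Set.Icc (5 : ℝ) 8,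
      DriftFree.ApproximateSolution ⟨γ, 1 / 4, 2, 1, 2⟩ (γ ^ 2 - 3)) :
    K3LocalisedClosure :=
  k3LocalisedClosure_of_approxSol_point fun hK2 => hA hK2 5 ⟨le_rfl, by norm_num⟩

/-- **K3loc from the approximate solution on any sub-box containing the glue point**: a statement
`K2″ → ∀ γ ∈ [5,8], ∀ ρN ∈ S, ApproximateSolution ⟨γ,¼,2,1,ρN⟩ (γ²−3)` over a finset `S ∋ 2` (e.g. `S = {ρN | 4ρN² < γ² − 3}`-type
sub-boxes written as `Finset.Icc 2 k`) closes `K3LocalisedClosure`. -/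
theorem k3LocalisedClosure_of_approxSol_subbox {S : Finset ℕ} (hS : 2 ∈ S)
    (hA : K2LinearisedCascadeGrowth → ∀ γ ∈ Set.Icc (5 : ℝ) 8, ∀ ρN ∈ S,
      DriftFree.ApproximateSolution ⟨γ, 1 / 4, 2, 1, ρN⟩ (γ ^ 2 - 3)) :
    K3LocalisedClosure :=
  k3LocalisedClosure_of_approxSol_point fun hK2 => hA hK2 5 ⟨le_rfl, by norm_num⟩ 2 hS

/-- **The rung `Target` from K1loc, K2″ and the approximate solution at the glue point** (`K3LocalisedClosure` unfolded). -/
theorem target_of_approxSol_point (hK1 : K1LocalisedCascade) (hK2 : K2LinearisedCascadeGrowth)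
    (hA : DriftFree.ApproximateSolution ⟨5, 1 / 4, 2, 1, 2⟩ ((5 : ℝ) ^ 2 - 3)) : Target :=
  k3LocalisedClosure_of_approxSol_point (fun _ => hA) hK1 hK2

end Summit.AnomalousDissipation.AnomalousDissipation.Theorems.SawtoothPulseCascade

end
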